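import Summits.QuantumFields.YangMills.Theorems.IR.EsPolymerESMeasures
import Summits.QuantumFields.YangMills.Theorems.IR.EsPolymerDefsK

/-!
# Crux `IR` (item stmt-QuantumFields-19354) — line «es-polymer-decoupling», reshaped engine, input (c1): CONDITIONING A
HARD-CORE GAS ON ITS ANCHORED PART; the cell gas as a tree `polymerPartitionFunction`

Helper module for item `stmt-QuantumFields-19354` (`--supports … --as helper`; it closes nothing; lead prover
ym-ir-line-mxc-p1 g2).  First input of the missing two-region mixing (c) of the OPEN engine `PolymerEngineK`
(`Theorems/IR/EsPolymerDefsK.lean`), in the vocabulary of the tree's Kotecký–Preiss layer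
(`Literature/Probability/LatticeModels/PolymerGas`, `…/ClusterExpansion`):

* `sum_prod_filter_inter_eq` (abstract hard-core gas, symmetric incompatibility): for an anchored set of polymers
  `𝒜 ⊆ Λ` and a compatible `X ⊆ 𝒜`,
  `∑_{Γ ⊆ Λ compatible, Γ ∩ 𝒜 = X} ∏_Γ z = (∏_X z) · Ξ(Λ ∖ 𝒜 ∖ N(X))`, where `Λ ∖ 𝒜 ∖ N(X)` are the non-anchored
  polymers compatible with `X` — so that, with `polymerPartitionFunction_sdiff_div_eq_exp` ([KP86, (5)]), the law of the
  anchored part is a ratio of partition functions = `exp (−∑_{clusters meeting the excluded polymers} Φ^T)`;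
* `compatible_iff` — the line's `Compatible Γ` (polymers pairwise at cell distance `≥ 7`) is "all members are polymers and
  `IsCompatible (GeomInc (cellDist ≤ 6)) Γ`"; `nearFamily_eq_inter` — the near family is the anchored part for
  `𝒜 = {γ : ∃ c' ∈ γ, cellDist c c' ≤ k+1}`.

HONEST FRAMING: bookkeeping for an OPEN engine stub of a CONDITIONAL rung line; no mixing, no clustering, no polymer
representation at weak coupling and no mass gap is proved here. -/

set_option autoImplicit false

noncomputable section

open Finset
open Literature.Probability.LatticeModels (IsCompatible polymerPartitionFunction GeomInc Touches IsCompatible.mono)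

namespace Summit.QuantumFields.YangMills.Cruxes.IR.EsPolymer

/-! ## §1 Abstract hard-core gas: prescribing the anchored part -/

section Abstract

variable {P : Type*} [DecidableEq P] {inc : P → P → Prop} [DecidableRel inc]

/-- **Conditioning a hard-core gas on its anchored part.**  For a symmetric incompatibility, an anchored set `𝒜 ⊆ Λ` and
a compatible `X ⊆ 𝒜`: the total weight of the compatible families `Γ ⊆ Λ` with `Γ ∩ 𝒜 = X` is `(∏_X z) · Ξ` of the
non-anchored polymers compatible with every member of `X`. -/
theorem sum_prod_filter_inter_eq (hsymm : ∀ a b, inc a b → inc b a) (z : P → ℂ) {Λ 𝒜 X : Finset P}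
    (h𝒜 : 𝒜 ⊆ Λ) (hX : X ⊆ 𝒜) (hXc : IsCompatible inc X) :
    ∑ Γ ∈ Λ.powerset with (IsCompatible inc Γ ∧ Γ ∩ 𝒜 = X), ∏ γ ∈ Γ, z γ =
      (∏ x ∈ X, z x) *
        polymerPartitionFunction inc z (Λ.filter fun γ => γ ∉ 𝒜 ∧ ∀ x ∈ X, ¬ inc x γ) := by
  set Λf : Finset P := Λ.filter fun γ => γ ∉ 𝒜 ∧ ∀ x ∈ X, ¬ inc x γ with hΛf
  unfold polymerPartitionFunction
  rw [← sum_filter, mul_sum]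
  symm
  refine sum_bij' (fun Γ' _ => X ∪ Γ') (fun Γ _ => Γ \ X) (fun Γ' hΓ' => ?_) (fun Γ hΓ => ?_)
    (fun Γ' hΓ' => ?_) (fun Γ hΓ => ?_) (fun Γ' hΓ' => ?_)
  · -- `X ∪ Γ'` is a compatible family of `Λ` with anchored part `X`
    obtain ⟨hΓ'Λf, hΓ'c⟩ := mem_filter.1 hΓ'
    have hΓ'sub : Γ' ⊆ Λf := mem_powerset.1 hΓ'Λf
    refine mem_filter.2 ⟨mem_powerset.2 (union_subset (hX.trans h𝒜) (hΓ'sub.trans (filter_subset _ _))),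
      ?_, ?_⟩
    · intro a ha b hb hab
      rw [mem_coe, mem_union] at ha hb
      rcases ha with ha | ha <;> rcases hb with hb | hb
      · exact hXc (mem_coe.2 ha) (mem_coe.2 hb) hab
      · exact (mem_filter.1 (hΓ'sub hb)).2.2 a ha
      · exact fun h => (mem_filter.1 (hΓ'sub ha)).2.2 b hb (hsymm a b h)
      · exact hΓ'c (mem_coe.2 ha) (mem_coe.2 hb) hab
    · ext γ
      simp only [mem_inter, mem_union]
      constructor
      · rintro ⟨hγ | hγ, hγ𝒜⟩
        · exact hγ
        · exact absurd hγ𝒜 (mem_filter.1 (hΓ'sub hγ)).2.1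
      · exact fun hγ => ⟨Or.inl hγ, hX hγ⟩
  · -- `Γ ∖ X` is a compatible family of non-anchored polymers compatible with `X`
    obtain ⟨hΓΛ, hΓc, hΓX⟩ := mem_filter.1 hΓ
    have hΓsub : Γ ⊆ Λ := mem_powerset.1 hΓΛ
    refine mem_filter.2 ⟨mem_powerset.2 fun γ hγ => ?_, hΓc.mono sdiff_subset⟩
    obtain ⟨hγΓ, hγX⟩ := mem_sdiff.1 hγ
    have hγ𝒜 : γ ∉ 𝒜 := fun h => hγX (by rw [← hΓX]; exact mem_inter.2 ⟨hγΓ, h⟩)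
    refine mem_filter.2 ⟨hΓsub hγΓ, hγ𝒜, fun x hx => ?_⟩
    have hxΓ : x ∈ Γ := (mem_inter.1 (hΓX.symm ▸ hx : x ∈ Γ ∩ 𝒜)).1
    have hne : x ≠ γ := fun h => hγ𝒜 (h ▸ hX hx)
    exact hΓc (mem_coe.2 hxΓ) (mem_coe.2 hγΓ) hne
  · -- left inverse
    obtain ⟨hΓ'Λf, -⟩ := mem_filter.1 hΓ'
    have hdisj : Disjoint X Γ' := disjoint_left.2 fun x hx hx' =>
      (mem_filter.1 (mem_powerset.1 hΓ'Λf hx')).2.1 (hX hx)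
    rw [union_sdiff_left, sdiff_eq_self_of_disjoint hdisj.symm]
  · -- right inverse
    obtain ⟨-, -, hΓX⟩ := mem_filter.1 hΓ
    have hXΓ : X ⊆ Γ := fun x hx => (mem_inter.1 (hΓX.symm ▸ hx : x ∈ Γ ∩ 𝒜)).1
    rw [union_sdiff_of_subset hXΓ]
  · -- weights
    obtain ⟨hΓ'Λf, -⟩ := mem_filter.1 hΓ'
    have hdisj : Disjoint X Γ' := disjoint_left.2 fun x hx hx' =>
      (mem_filter.1 (mem_powerset.1 hΓ'Λf hx')).2.1 (hX hx)
    rw [prod_union hdisj]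

/-- The weight of a prescribed anchored part vanishes unless it is compatible (and `⊆ 𝒜`). -/
theorem sum_prod_filter_inter_eq_zero (z : P → ℂ) {Λ 𝒜 X : Finset P} (hX : ¬ (IsCompatible inc X ∧ X ⊆ 𝒜)) :
    ∑ Γ ∈ Λ.powerset with (IsCompatible inc Γ ∧ Γ ∩ 𝒜 = X), ∏ γ ∈ Γ, z γ = 0 := by
  refine sum_eq_zero fun Γ hΓ => ?_
  obtain ⟨-, hΓc, hΓX⟩ := mem_filter.1 hΓ
  exact absurd ⟨hΓc.mono (by rw [← hΓX]; exact inter_subset_left), by rw [← hΓX]; exact inter_subset_right⟩ hX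

end Abstract

/-! ## §2 The cell gas of the line in the tree's vocabulary -/

/-- **The line's compatibility is the tree's**: `Compatible Γ` iff every member is a polymer and `Γ` is `IsCompatible` for
the geometric incompatibility of the step relation `cellDist ≤ 6` (equal or touching). -/
theorem compatible_iff {q : ℕ} (Γ : Finset (Finset (Cell q))) :
    Compatible Γ ↔ (∀ γ ∈ Γ, IsPolymer γ) ∧ IsCompatible (GeomInc fun x y : Cell q => cellDist x y ≤ 6) Γ := by
  constructor
  · intro hΓ
    refine ⟨hΓ.1, fun X hX Y hY hne hinc => ?_⟩
    rcases hinc with h | ⟨w, hw, v, hv, h⟩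
    · exact hne h
    · have h7 := hΓ.2 X hX Y hY hne w hw v hv
      rcases h with rfl | h
      · have := cellDist_self w; omega
      · omega
  · rintro ⟨hpoly, hcomp⟩
    refine ⟨hpoly, fun X hX Y hY hne w hw v hv => ?_⟩
    by_contra hlt
    exact hcomp (mem_coe.2 hX) (mem_coe.2 hY) hne (Or.inr ⟨w, hw, v, hv, Or.inr (by omega)⟩)

/-- The geometric incompatibility of the cell gas is symmetric. -/
theorem geomInc_cellDist_symm {q : ℕ} (X Y : Finset (Cell q))
    (h : GeomInc (fun x y : Cell q => cellDist x y ≤ 6) X Y) : GeomInc (fun x y : Cell q => cellDist x y ≤ 6) Y X := by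
  rcases h with rfl | ⟨w, hw, v, hv, h⟩
  · exact Or.inl rfl
  · refine Or.inr ⟨v, hv, w, hw, ?_⟩
    rcases h with rfl | h
    · exact Or.inl rfl
    · exact Or.inr (show cellDist v w ≤ 6 by rwa [cellDist_comm])

/-- The near family is the anchored part for the anchored set "has a cell within `k+1` of `c`". -/
theorem nearFamily_eq_inter {q : ℕ} [DecidableEq (Finset (Cell q))] (Γ : Finset (Finset (Cell q))) (c : Cell q) (k : ℕ) :
    nearFamily Γ c k = Γ ∩ Finset.univ.filter fun γ : Finset (Cell q) => ∃ c' ∈ γ, cellDist c c' ≤ k + 1 := by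
  ext γ
  simp [mem_nearFamily]

open Classical in
/-- **The masses of a representation as a hard-core gas in the tree's vocabulary**: with activities `act` extended by `0`
off the polymers, `∑_{Γ compatible, nearFamily Γ c k = X} ∏_Γ act` is the abstract anchored-part weight of §1 for the
volume `Λ = {polymers}` and the anchored set `{polymers near the block}`. -/
theorem sum_prod_filter_nearFamily_eq {q : ℕ} (act : Finset (Cell q) → ℝ) (c : Cell q) (k : ℕ)
    (X : Finset (Finset (Cell q))) :
    ((∑ Γ ∈ Finset.univ.filter (fun Γ : Finset (Finset (Cell q)) => Compatible Γ ∧ nearFamily Γ c k = X),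
        ∏ γ ∈ Γ, act γ : ℝ) : ℂ) =
      ∑ Γ ∈ (Finset.univ.filter fun γ : Finset (Cell q) => IsPolymer γ).powerset with
          (IsCompatible (GeomInc fun x y : Cell q => cellDist x y ≤ 6) Γ ∧
            Γ ∩ ((Finset.univ.filter fun γ : Finset (Cell q) => IsPolymer γ).filter
              fun γ => ∃ c' ∈ γ, cellDist c c' ≤ k + 1) = X),
        ∏ γ ∈ Γ, ((act γ : ℝ) : ℂ) := by
  push_cast
  refine sum_congr ?_ fun Γ _ => rfl
  ext Γ
  simp only [mem_filter, mem_univ, true_and, mem_powerset]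
  constructor
  · rintro ⟨hΓ, hX⟩
    obtain ⟨hpoly, hcomp⟩ := (compatible_iff Γ).1 hΓ
    refine ⟨fun γ hγ => mem_filter.2 ⟨mem_univ _, hpoly γ hγ⟩, hcomp, ?_⟩
    rw [← hX, nearFamily_eq_inter]
    ext γ
    simp only [mem_inter, mem_filter, mem_univ, true_and]
    exact ⟨fun ⟨h1, _, h3⟩ => ⟨h1, h3⟩, fun ⟨h1, h3⟩ => ⟨h1, hpoly γ h1, h3⟩⟩
  · rintro ⟨hsub, hcomp, hX⟩
    have hpoly : ∀ γ ∈ Γ, IsPolymer γ := fun γ hγ => (mem_filter.1 (hsub hγ)).2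
    refine ⟨(compatible_iff Γ).2 ⟨hpoly, hcomp⟩, ?_⟩
    rw [← hX, nearFamily_eq_inter]
    ext γ
    simp only [mem_inter, mem_filter, mem_univ, true_and]
    exact ⟨fun ⟨h1, h3⟩ => ⟨h1, hpoly γ h1, h3⟩, fun ⟨h1, _, h3⟩ => ⟨h1, h3⟩⟩

end Summit.QuantumFields.YangMills.Cruxes.IR.EsPolymer

end
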